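import Mathlib.Data.Nat.Choose.Bounds
import Mathlib.Algebra.Polynomial.Degree.SmallDegree
import Literature.NumberTheory.DiophantineApproximation.PolylogTwoPointHermitePade
import HarnessLib

/-!
# Type-I Hermite–Padé forms for `1, Li_s(1/N), Li_s(−1/N)` (`s ≤ w`) — arithmetic of the parity bricks

Topic `Literature/NumberTheory/DiophantineApproximation`. Continuation of
`PolylogTwoPointHermitePade.lean` (the vocabulary `stepTwoBinom`, `resP`, `kernelH` of the parity
reduction of David–Hirata-Kohno–Kawashima 2020, Thm 2.1, at the two points `±1/N`). In the doubled
variable `t = 2u` the parity kernel `K^{(w)}_n(u) = 4^{wn} (u − wn + 1)_{wn}/(2u+1)_{n+1}^w` is the product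
of the `w` BRICKS

  `4^n (t/2 − (s+1)n + 1)_n / (t+1)_{n+1}`   (`s < w`),

rational functions of `t` with the simple poles `t = −1, …, −(n+1)` and a numerator of degree `n`, hence
(Lagrange division at the nodes `−1, …, −(n+1)`, `BallRivoal.lagrange_div`) of the shape
`∑_{m ≤ n} A_m/(t+m+1)`. This file proves that the residues `A_m` are the INTEGERS
`resP n s m = (−1)^{n+m} C(n,m) E(m+1+2sn, n)` and bounds them, exactly what Rivoal's one-point bricks
`F_l` get from `BallRivoal.F_eq_brickEval` / `BallRivoal.sum_abs_resF_le`: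

* `stepTwoBinom_mul_factorial`: the closed form `E(q, n) · n! = 2^n ∏_{i<n} (q + 2i)` of the even-step
  binomial numbers (from the Pascal-type recursion defining `stepTwoBinom`);
* `stepTwoBinom_le`: `E(q, n) ≤ 4^n C(q+n, n)`;
* `brick_eq_brickEval`: `4^n (t/2 − (s+1)n + 1)_n/(t+1)_{n+1} = ∑_{m ≤ n} (resP n s m)/(t+m+1)` for
  `t ∉ {−1, …, −(n+1)}` (the numerator at `t = −m−1` is `(−2)^n ∏_{i<n} (m − 1 + 2sn + 2n − 2i)
  = (−1)^n 2^n ∏_{i<n} (m + 1 + 2sn + 2i) = (−1)^n n! E(m+1+2sn, n)` after the reflection `i ↦ n−1−i`);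
* `sum_abs_resP_le`: `∑_{m ≤ n} |resP n s m| ≤ 2^{(2s+5)n+1}` (from `C(n,m) ≤ 2^n`-type bounds and
  `∑_m C(n,m) = 2^n`).

Everything is PROVED; no definitions, no named facts. The product formula for the kernel and its partial
fraction expansion are in `PolylogTwoPointHermitePadeExpansion.lean`.

References: S. David, N. Hirata-Kohno, M. Kawashima, *Can polylogarithms at algebraic points be linearly
independent?*, Moscow J. Comb. Number Th. 9 (2020) 389–406, Thm 2.1 [DavidHirataKohnoKawashima2020];
T. Rivoal, C. R. Acad. Sci. Paris 331 (2000), §2 proof of Lemme 5 (the brick mechanism) [Rivoal2000].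
-/

open Finset Polynomial

namespace Literature.NumberTheory.DiophantineApproximation

namespace ParityPade

open Literature.NumberTheory.Transcendental

/-! ### The even-step binomial numbers in closed form -/

/-- `C(2n, n) · n! = 2^n · 1 · 3 ⋯ (2n−1) = 2^n ∏_{i<n} (1 + 2i)` (the case `q = 1` of
`stepTwoBinom_mul_factorial`, from `(n+1) C(2n+2, n+1) = 2 (2n+1) C(2n, n)`). [folklore] -/
private theorem centralBinom_mul_factorial (n : ℕ) :
    ((Nat.centralBinom n : ℕ) : ℚ) * (n.factorial : ℚ) =
      2 ^ n * ∏ i ∈ Finset.range n, ((1 : ℚ) + 2 * i) := by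
  induction n with
  | zero => simp
  | succ n ih =>
    have h : ((n : ℚ) + 1) * ((Nat.centralBinom (n + 1) : ℕ) : ℚ) =
        2 * (2 * n + 1) * ((Nat.centralBinom n : ℕ) : ℚ) := by
      exact_mod_cast Nat.succ_mul_centralBinom_succ n
    rw [Nat.factorial_succ, prod_range_succ, pow_succ]
    push_cast
    linear_combination (n.factorial : ℚ) * h + 2 * (2 * (n : ℚ) + 1) * ih

/-- **Closed form of the even-step binomial numbers**: `E(q, n) · n! = 2^n q (q+2) ⋯ (q+2n−2)
= 2^n ∏_{i<n} (q + 2i)`, by the recursion `E(q+2, n+1) = E(q, n+1) + 4 E(q+2, n)`: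
`2^{n+1} q P + 4 (n+1) 2^n P = 2^{n+1} P (q + 2(n+1))` with `P = ∏_{i<n} (q + 2 + 2i)`. [folklore] -/
theorem stepTwoBinom_mul_factorial (q n : ℕ) :
    ((stepTwoBinom q n : ℕ) : ℚ) * (n.factorial : ℚ) =
      2 ^ n * ∏ i ∈ Finset.range n, ((q : ℚ) + 2 * i) := by
  induction q, n using stepTwoBinom.induct with
  | case1 q => simp [stepTwoBinom_zero_right]
  | case2 n =>
    show ((stepTwoBinom 0 (n + 1) : ℕ) : ℚ) * ((n + 1).factorial : ℚ) =
      2 ^ (n + 1) * ∏ i ∈ Finset.range (n + 1), (((0 : ℕ) : ℚ) + 2 * i)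
    rw [stepTwoBinom_zero_succ, prod_range_succ']
    simp
  | case3 n =>
    show ((stepTwoBinom 1 (n + 1) : ℕ) : ℚ) * ((n + 1).factorial : ℚ) =
      2 ^ (n + 1) * ∏ i ∈ Finset.range (n + 1), (((1 : ℕ) : ℚ) + 2 * i)
    rw [stepTwoBinom_one, Nat.cast_one]
    exact centralBinom_mul_factorial (n + 1)
  | case4 q n ih1 ih2 =>
    have ih1' : ((stepTwoBinom q (n + 1) : ℕ) : ℚ) * ((n + 1).factorial : ℚ) =
        2 ^ (n + 1) * ∏ i ∈ Finset.range (n + 1), ((q : ℚ) + 2 * i) := ih1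
    have ih2' : ((stepTwoBinom (q + 2) n : ℕ) : ℚ) * (n.factorial : ℚ) =
        2 ^ n * ∏ i ∈ Finset.range n, (((q + 2 : ℕ) : ℚ) + 2 * i) := ih2
    show ((stepTwoBinom (q + 2) (n + 1) : ℕ) : ℚ) * ((n + 1).factorial : ℚ) =
      2 ^ (n + 1) * ∏ i ∈ Finset.range (n + 1), (((q + 2 : ℕ) : ℚ) + 2 * i)
    have hP1 : ∏ i ∈ range (n + 1), ((q : ℚ) + 2 * i) =
        q * ∏ i ∈ range n, ((q : ℚ) + 2 + 2 * i) := by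
      rw [prod_range_succ', mul_comm]
      congr 1
      · simp
      · exact prod_congr rfl fun i _ => by push_cast; ring
    have hP3 : ∏ i ∈ range n, (((q + 2 : ℕ) : ℚ) + 2 * i) = ∏ i ∈ range n, ((q : ℚ) + 2 + 2 * i) :=
      prod_congr rfl fun i _ => by rw [Nat.cast_add, Nat.cast_ofNat]
    have hP2 : ∏ i ∈ range (n + 1), (((q + 2 : ℕ) : ℚ) + 2 * i) =
        (∏ i ∈ range n, ((q : ℚ) + 2 + 2 * i)) * ((q : ℚ) + 2 + 2 * n) := by
      rw [prod_range_succ, hP3, Nat.cast_add, Nat.cast_ofNat]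
    rw [stepTwoBinom_succ_succ, hP2, Nat.factorial_succ, pow_succ]
    rw [hP1, pow_succ, Nat.factorial_succ] at ih1'
    rw [hP3] at ih2'
    push_cast at ih1' ⊢
    linear_combination ih1' + 4 * ((n : ℚ) + 1) * ih2'

/-- `E(q, n) ≤ 4^n C(q+n, n)`, by the recursion and Pascal's rule
`C(q+n+3, n+1) = C(q+n+2, n) + C(q+n+2, n+1)` (`E(1, n) = C(2n, n) ≤ 4^n`). [folklore] -/
theorem stepTwoBinom_le (q n : ℕ) : stepTwoBinom q n ≤ 4 ^ n * (q + n).choose n := by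
  induction q, n using stepTwoBinom.induct with
  | case1 q => simp [stepTwoBinom_zero_right]
  | case2 n => simp [stepTwoBinom_zero_succ]
  | case3 n =>
    show stepTwoBinom 1 (n + 1) ≤ 4 ^ (n + 1) * (1 + (n + 1)).choose (n + 1)
    rw [stepTwoBinom_one]
    exact (Nat.centralBinom_le_four_pow (n + 1)).trans
      (Nat.le_mul_of_pos_right _ (Nat.choose_pos (by omega)))
  | case4 q n ih1 ih2 =>
    have ih1' : stepTwoBinom q (n + 1) ≤ 4 ^ (n + 1) * (q + (n + 1)).choose (n + 1) := ih1
    have ih2' : stepTwoBinom (q + 2) n ≤ 4 ^ n * (q + 2 + n).choose n := ih2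
    show stepTwoBinom (q + 2) (n + 1) ≤ 4 ^ (n + 1) * (q + 2 + (n + 1)).choose (n + 1)
    rw [stepTwoBinom_succ_succ]
    have e : (q + 2 + (n + 1)).choose (n + 1) =
        (q + n + 2).choose n + (q + n + 2).choose (n + 1) := by
      rw [show q + 2 + (n + 1) = (q + n + 2) + 1 by ring, Nat.choose_succ_succ']
    have h1 : (q + (n + 1)).choose (n + 1) ≤ (q + n + 2).choose (n + 1) :=
      Nat.choose_le_choose _ (by omega)
    have h2 : (q + 2 + n).choose n = (q + n + 2).choose n := by
      rw [show q + 2 + n = q + n + 2 by ring]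
    rw [h2] at ih2'
    rw [e]
    calc stepTwoBinom q (n + 1) + 4 * stepTwoBinom (q + 2) n
        ≤ 4 ^ (n + 1) * (q + n + 2).choose (n + 1) + 4 * (4 ^ n * (q + n + 2).choose n) :=
          Nat.add_le_add (ih1'.trans (Nat.mul_le_mul_left _ h1)) (Nat.mul_le_mul_left 4 ih2')
      _ = 4 ^ (n + 1) * ((q + n + 2).choose n + (q + n + 2).choose (n + 1)) := by
          rw [pow_succ]
          ring

/-! ### The parity brick and its residues -/

/-- The numerator of the parity brick `s` at the node `t = −m−1`:
`4^n ((−m−1)/2 − (s+1)n + 1)_n = (−2)^n ∏_{i<n} (m − 1 + 2sn + 2n − 2i) = (−1)^n n! E(m+1+2sn, n)`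
(reflect `i ↦ n − 1 − i` and use `stepTwoBinom_mul_factorial`). [folklore] -/
private theorem four_pow_mul_poch_node (n s m : ℕ) :
    (4 : ℚ) ^ n * BallRivoal.poch ((-(m : ℚ) - 1) / 2 - ((s : ℚ) + 1) * n + 1) n =
      (-1) ^ n * (((stepTwoBinom (m + 1 + 2 * s * n) n : ℕ) : ℚ) * n.factorial) := by
  have hrefl : ∏ i ∈ range n, (((m + 1 + 2 * s * n : ℕ) : ℚ) + 2 * (i : ℚ)) =
      ∏ i ∈ range n, (((m + 1 + 2 * s * n : ℕ) : ℚ) + 2 * ((n - 1 - i : ℕ) : ℚ)) :=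
    (prod_range_reflect (fun j => ((m + 1 + 2 * s * n : ℕ) : ℚ) + 2 * (j : ℚ)) n).symm
  rw [stepTwoBinom_mul_factorial, hrefl, BallRivoal.poch, ← mul_assoc, ← mul_pow, show (4 : ℚ) ^ n = ∏ _i ∈ range n, (4 : ℚ) by rw [prod_const, card_range],
    show ((-1 : ℚ) * 2) ^ n = ∏ _i ∈ range n, ((-1 : ℚ) * 2) by rw [prod_const, card_range],
    ← prod_mul_distrib, ← prod_mul_distrib]
  refine prod_congr rfl fun i hi => ?_
  have hi' : i < n := mem_range.1 hi
  rw [Nat.cast_sub (by omega : i ≤ n - 1), Nat.cast_sub (by omega : 1 ≤ n)]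
  push_cast
  ring

/-- **The parity brick is a Ball–Rivoal brick with integer residues**: for `t ∉ {−1, …, −(n+1)}`,
`4^n (t/2 − (s+1)n + 1)_n / (t+1)_{n+1} = ∑_{m ≤ n} (resP n s m)/(t + m + 1)` with
`resP n s m = (−1)^{n+m} C(n,m) E(m+1+2sn, n)` — Lagrange division (`BallRivoal.lagrange_div`) of the
degree-`n` numerator `4^n ∏_{i<n} (t/2 − (s+1)n + 1 + i)` at the nodes `−1, …, −(n+1)`, whose values
there are `(−1)^n n! E(m+1+2sn, n)`. This is the two-point analogue of Rivoal's `F_l`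
(`BallRivoal.F_eq_brickEval`). [cite: DavidHirataKohnoKawashima2020, Thm 2.1] -/
theorem brick_eq_brickEval (n s : ℕ) (t : ℚ) (ht : ∀ m, m ≤ n → t + m + 1 ≠ 0) :
    (4 : ℚ) ^ n * BallRivoal.poch (t / 2 - (s + 1) * n + 1) n / BallRivoal.poch (t + 1) (n + 1) =
      BallRivoal.brickEval n (resP n s) t := by
  set P : ℚ[X] := C ((4 : ℚ) ^ n) *
    ∏ i ∈ range n, (C (1 / 2 : ℚ) * X + C (1 - ((s : ℚ) + 1) * n + i)) with hP
  have hPeval : ∀ x : ℚ, P.eval x = 4 ^ n * BallRivoal.poch (x / 2 - (s + 1) * n + 1) n := by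
    intro x
    rw [hP, eval_mul, eval_C, eval_prod, BallRivoal.poch]
    congr 1
    refine prod_congr rfl fun i _ => ?_
    rw [eval_add, eval_mul, eval_C, eval_X, eval_C]
    ring
  have hdeg : P.degree < ((n + 1 : ℕ) : WithBot ℕ) := by
    have h : P.natDegree ≤ n := by
      rw [hP]
      refine (natDegree_C_mul_le _ _).trans ((natDegree_prod_le _ _).trans ?_)
      refine (sum_le_sum (fun (i : ℕ) _ =>
        (natDegree_linear_le : (C (1 / 2 : ℚ) * X + C (1 - ((s : ℚ) + 1) * n + i)).natDegree ≤ 1))).trans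
        ?_
      simp
    exact (degree_le_of_natDegree_le h).trans_lt (WithBot.coe_lt_coe.2 (Nat.lt_succ_self n))
  have h := BallRivoal.lagrange_div n P hdeg t ht
  rw [hPeval] at h
  rw [h, BallRivoal.brickEval]
  refine sum_congr rfl fun m hm => ?_
  have hm' : m ≤ n := Nat.lt_succ_iff.1 (mem_range.1 hm)
  rw [hPeval]
  congr 1
  rw [four_pow_mul_poch_node n s m, resP]
  have hf : ((m.factorial : ℚ) * (n - m).factorial) ≠ 0 := by positivity
  push_cast
  rw [Nat.cast_choose ℚ hm']
  field_simp
  ring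

/-! ### Bounds for the residues -/

/-- `∑_{m ≤ n} |resP n s m| ≤ 2^{(2s+5)n+1}`: `|resP n s m| = C(n,m) E(m+1+2sn, n) ≤
C(n,m) 4^n C(m+1+2sn+n, n) ≤ C(n,m) 4^n 2^{(2s+2)n+1}` (`m ≤ n`) and `∑_m C(n,m) = 2^n`. [folklore] -/
theorem sum_abs_resP_le (n s : ℕ) :
    ∑ m ∈ Finset.range (n + 1), |(resP n s m : ℚ)| ≤ (2 : ℚ) ^ ((2 * s + 5) * n + 1) := by
  have h : ∀ m ∈ range (n + 1),
      |(resP n s m : ℚ)| ≤ (n.choose m : ℚ) * (2 : ℚ) ^ ((2 * s + 4) * n + 1) := by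
    intro m hm
    have hm' : m ≤ n := Nat.lt_succ_iff.1 (mem_range.1 hm)
    have h1 : stepTwoBinom (m + 1 + 2 * s * n) n ≤ 2 ^ ((2 * s + 4) * n + 1) := by
      calc stepTwoBinom (m + 1 + 2 * s * n) n
          ≤ 4 ^ n * (m + 1 + 2 * s * n + n).choose n := stepTwoBinom_le _ _
        _ ≤ 4 ^ n * 2 ^ (m + 1 + 2 * s * n + n) :=
          Nat.mul_le_mul_left _ (Nat.choose_le_two_pow _ _)
        _ ≤ 4 ^ n * 2 ^ (n + 1 + 2 * s * n + n) :=
          Nat.mul_le_mul_left _ (Nat.pow_le_pow_right (by norm_num) (by omega))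
        _ = 2 ^ ((2 * s + 4) * n + 1) := by
          rw [show (4 : ℕ) = 2 ^ 2 by norm_num, ← pow_mul, ← pow_add]
          congr 1
          ring
    have h1' : ((stepTwoBinom (m + 1 + 2 * s * n) n : ℕ) : ℚ) ≤ (2 : ℚ) ^ ((2 * s + 4) * n + 1) := by
      exact_mod_cast h1
    rw [resP]
    push_cast
    rw [abs_mul, abs_mul, abs_pow, abs_neg, abs_one, one_pow, one_mul, Nat.abs_cast, Nat.abs_cast]
    exact mul_le_mul_of_nonneg_left h1' (Nat.cast_nonneg _)
  refine (sum_le_sum h).trans ?_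
  rw [← sum_mul, ← Nat.cast_sum, Nat.sum_range_choose]
  push_cast
  rw [← pow_add]
  exact le_of_eq (by congr 1; ring)

end ParityPade

end Literature.NumberTheory.DiophantineApproximation
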